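import Summits.CriticalPhenomena.PercolationContinuityZ3.Theorems.PercNearOneGluingNoHeavyLowerTailIncStarTwoSepGlue
import Summits.CriticalPhenomena.PercolationContinuityZ3.Theorems.PercNearOneGluingNoHeavyLowerTailIncStarApexUnicyclic
import Summits.CriticalPhenomena.PercolationContinuityZ3.Theorems.PercNearOneGluingNoHeavyLowerTailIncStarApexForest
import HarnessLib

/-!
# A minimal counterexample to the increasing star has a 2-connected environment with at least two cycles and violates E-MIN everywhere

Support file for the Sahi programme (`--supports stmt-CriticalPhenomena-4575`, prover prim-sahi-p2 gen 23).  No definitions, no named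
facts, no sorries; standard axioms.  Memo `run/shared/lean/prim/prim-sahi/FROM-prim-sahi-p2-gen22-TWO-SEPARATION-GLUING.md` §3
(COROLLARY M / B), `prim-sahi-p2/PROOF-E3.md` §23, §32–§33.

**Theorem `incStar_of_irreducible₂`** — gen 12's `IncStarIrreducible.incStar_of_irreducible` with one more reduction.  Suppose the
increasing-star inequality `0 ≤ E₃({s↔a},{s↔b},{s↔c})` holds for every weight `w : Sym2 (Fin n) → [0,1]` and all marks `s, a, b, c`
forming an IRREDUCIBLE marked weighted graph WITH 2-CONNECTED ENVIRONMENT, namely (clauses of gen 12)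
* the four marks are pairwise distinct and `w` has no loops;
* (2-connected through cut vertices of `G`) every cut-vertex decomposition `V₁ ∪ V₂`, `V₁ ∩ V₂ = {x}`, `s ∈ V₁`, is trivial;
* (degree) no unmarked vertex of weighted degree `≤ 2`;  * (no blob) no markless two-terminal piece;  * (no root side) no targetless
  two-terminal piece containing the root;
and the NEW clauses
* (2-connected environment) for every vertex `x ≠ s` and every vertex set `L` with `s, x ∉ L`, `L ≠ ∅` and `V ∖ (L ∪ {s,x}) ≠ ∅` there
  is a pair of positive weight between `L` and `V ∖ (L ∪ {s,x})` — i.e. no vertex `x` separates the environment `H = G − s`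
  (the positive pairs avoiding the root): `H − x` is connected for every `x`, so together with the cut-vertex clause at `x = s`
  the environment is 2-connected;
* (at least two cycles) the environment `H` is not a forest after deleting any single pair (cyclomatic number `≥ 2`);
* (E-MIN violated everywhere) some environment pair has a weight strictly between `0` and `1`, and along EVERY such pair `e` the cubic
  `E₃` lies strictly below both endpoint values: `E₃(w) < E₃(w[e↦0])` and `E₃(w) < E₃(w[e↦1])` (gen 21's CONJECTURE E-MIN says this never
  happens).
Then the increasing star holds for EVERY weight on EVERY finite vertex type and all marks.

**The new reduction** (memo §3): if `{s, x}` separates `L` from `R = V ∖ (L ∪ {s,x})`, both nonempty, count the targets in `L`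
and in `R`: by the no-blob clause neither `L` nor `R` is targetless unless … (contradiction), so the targets split `1 | 2`
between `L` and `R ∪ {x}` (or `R` and `L ∪ {x}`), and THEOREM G (`IncStar.incStar_nonneg_of_twoSep`) reduces the star to the far
side with a boosted root weight at `x`, a vertex set of smaller size where the induction hypothesis applies
(`IncStarIrreducible.incStar_openConnIn_of_fin`).  The cycle clause is gen 21's `IncStar.incStar_nonneg_of_apexUnicyclic` (the star
on every weight whose environment has at most one cycle).  The E-MIN clauses come from an inner induction on the number of fractional
environment pairs (`EdgeInduction.fracEdges`): with none, every environment cycle is sure and gen 19's THEOREM C♯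
`IncStar.incStar_nonneg_of_sureEnvCycles` applies; if some fractional environment pair has an endpoint value below `E₃(w)`, the star at
`w` follows from the star at that endpoint (same vertex set, fewer fractional environment pairs).  What is NOT here: any claim that irreducible graphs with 2-connected
environment of cyclomatic number `≥ 2` satisfy the star (open; smallest cases `K₄ − e`, `K₂,₃`, `K₄` under an arbitrary root star;
certified for `n ≤ 7` by the K₇ fibre array, `n ≤ 8` by the M₈ array of memo §6 once folded).
-/

noncomputable section

namespace Summit.CriticalPhenomena.PercolationContinuityZ3.Theorems

namespace IncStarIrreducible

open Finset MeasureTheory Literature.Combinatorics.Sahi2008 Literature.Probability.Percolation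
  Literature.Probability.LatticeModels
open Literature.Probability.Percolation.DecisionTree (ind ind_of_mem ind_of_not_mem ind_nonneg)
open Literature.Probability.Percolation.BlockExploration (exists_openWalk_of_mem_openConnIn
  mem_openConn_iff_openConnIn_univ)
open scoped Classical

variable {V : Type*} [Fintype V]

/-- **The increasing star holds everywhere as soon as it holds on every irreducible marked weighted graph whose environment is
2-connected with at least two cycles and at which E-MIN fails along every fractional environment pair.**  See the module docstring for
the clauses (pairwise distinct marks, no loops, no cut vertex, no unmarked vertex of degree ≤ 2, no blob, no targetless root side, no
vertex separating the environment `G − s`, environment not a forest plus one pair, a fractional environment pair exists, `E₃(w)` strictly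
below both endpoint values along every fractional environment pair) and for the reductions used (gens 8, 10, 11, 12, 19, 21 and THEOREM G
of gens 22/23). [this work] -/
theorem incStar_of_irreducible₂
    (H : ∀ (n : ℕ) (w : Sym2 (Fin n) → unitInterval) (s a b c : Fin n),
      s ≠ a → s ≠ b → s ≠ c → a ≠ b → a ≠ c → b ≠ c →
      (∀ x : Fin n, w s(x, x) = 0) →
      (∀ (V₁ V₂ : Finset (Fin n)) (x : Fin n), (∀ y, y ∈ V₁ → y ∈ V₂ → y = x) → x ∈ V₁ → x ∈ V₂ → s ∈ V₁ →
          (∀ y, y ∈ V₁ ∨ y ∈ V₂) → (∀ y z, y ∈ V₁ → z ∈ V₂ → y ≠ x → z ≠ x → w s(y, z) = 0) →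
          (∀ y ∈ V₁, y = x) ∨ (∀ z ∈ V₂, z = x)) →
      (∀ x y y' : Fin n, x ≠ s → x ≠ a → x ≠ b → x ≠ c → x ≠ y → x ≠ y' → y ≠ y' →
          ∃ z, z ≠ y ∧ z ≠ y' ∧ w s(x, z) ≠ 0) →
      (∀ (B : Finset (Fin n)) (u v : Fin n), B.Nonempty → u ∉ B → v ∉ B → u ≠ v → s ∉ B → a ∉ B → b ∉ B → c ∉ B →
          ∃ x ∈ B, ∃ z, z ∉ B ∧ z ≠ u ∧ z ≠ v ∧ w s(x, z) ≠ 0) →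
      (∀ (R : Finset (Fin n)) (h u v : Fin n), s ∈ R → h ∈ R → h ≠ s → u ∉ R → v ∉ R → u ≠ v → a ∉ R → b ∉ R →
          c ∉ R → ∃ x ∈ R, ∃ z, z ∉ R ∧ z ≠ u ∧ z ≠ v ∧ w s(x, z) ≠ 0) →
      (∀ (L : Finset (Fin n)) (x : Fin n), x ≠ s → s ∉ L → x ∉ L → L.Nonempty → (∃ y, y ∉ L ∧ y ≠ s ∧ y ≠ x) →
          ∃ y ∈ L, ∃ z, z ∉ L ∧ z ≠ s ∧ z ≠ x ∧ w s(y, z) ≠ 0) →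
      (∀ z₀ : Sym2 (Fin n),
          ¬ ((SimpleGraph.fromEdgeSet {z : Sym2 (Fin n) | s ∉ z ∧ w z ≠ 0}).deleteEdges {z₀}).IsAcyclic) →
      (∃ e : Sym2 (Fin n), s ∉ e ∧ ¬ e.IsDiag ∧ e ∈ EdgeInduction.fracEdges w) →
      (∀ e : Sym2 (Fin n), s ∉ e → ¬ e.IsDiag → e ∈ EdgeInduction.fracEdges w →
          sahiE3 (prodBernoulli w) (openConn s a) (openConn s b) (openConn s c)
              < sahiE3 (prodBernoulli (Function.update w e 0)) (openConn s a) (openConn s b) (openConn s c) ∧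
            sahiE3 (prodBernoulli w) (openConn s a) (openConn s b) (openConn s c)
              < sahiE3 (prodBernoulli (Function.update w e 1)) (openConn s a) (openConn s b) (openConn s c)) →
      0 ≤ sahiE3 (prodBernoulli w) (openConn s a) (openConn s b) (openConn s c))
    (w : Sym2 V → unitInterval) (s a b c : V) :
    0 ≤ sahiE3 (prodBernoulli w) (openConn s a) (openConn s b) (openConn s c) := by
  -- the statement on `Fin n`, by strong induction on `n`
  have finv : ∀ (n : ℕ) (w : Sym2 (Fin n) → unitInterval) (s a b c : Fin n),
      0 ≤ sahiE3 (prodBernoulli w) (openConn s a) (openConn s b) (openConn s c) := by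
    intro n
    induction n using Nat.strong_induction_on with
    | _ n ih =>
    -- inner induction on the number of fractional environment pairs (non-loop pairs avoiding the root, weight strictly inside (0,1))
    suffices inner : ∀ (k : ℕ) (w : Sym2 (Fin n) → unitInterval) (s a b c : Fin n),
        ((EdgeInduction.fracEdges w).filter fun e => s ∉ e ∧ ¬ e.IsDiag).card ≤ k →
        0 ≤ sahiE3 (prodBernoulli w) (openConn s a) (openConn s b) (openConn s c) from
      fun w s a b c => inner _ w s a b c le_rfl
    intro k
    induction k with
    | zero =>
      intro w s a b c hk
      -- no fractional environment pair: every environment cycle is sure (gen 19, THEOREM C♯)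
      refine IncStar.incStar_nonneg_of_sureEnvCycles w s a b c fun u v hadj hne => ?_
      exfalso
      rw [SimpleGraph.fromEdgeSet_adj] at hadj
      obtain ⟨⟨hs, hw0⟩, huv⟩ := hadj
      have hmem : s(u, v) ∈ (EdgeInduction.fracEdges w).filter fun e => s ∉ e ∧ ¬ e.IsDiag := by
        refine Finset.mem_filter.2 ⟨?_, hs, by rwa [Sym2.mk_isDiag_iff]⟩
        by_contra h
        rcases EdgeInduction.eq_zero_or_one_of_not_mem_fracEdges h with h0 | h1
        · exact hw0 h0
        · exact hne h1
      have := Finset.card_pos.2 ⟨_, hmem⟩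
      omega
    | succ k ihk =>
    intro w₁ s a b c hk₁
    -- (0) coincident marks
    by_cases hdist : s ≠ a ∧ s ≠ b ∧ s ≠ c ∧ a ≠ b ∧ a ≠ c ∧ b ≠ c
    swap
    · push Not at hdist
      refine incStar_of_not_distinct w₁ ?_
      tauto
    obtain ⟨hsa, hsb, hsc, hab, hac, hbc⟩ := hdist
    -- loops off
    obtain ⟨w, hwdef⟩ : ∃ w : Sym2 (Fin n) → unitInterval, ∀ e, w e = if e.IsDiag then 0 else w₁ e := ⟨_, fun e => rfl⟩
    rw [sahiE3_openConn_congr_offDiag w₁ w (fun e he => by rw [hwdef, if_neg he]) s a b c]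
    have hloop : ∀ x : Fin n, w s(x, x) = 0 := fun x => by rw [hwdef, if_pos (Sym2.mk_isDiag_iff.2 rfl)]
    have hcardn : Fintype.card (Fin n) = n := Fintype.card_fin n
    have hk : ((EdgeInduction.fracEdges w).filter fun e => s ∉ e ∧ ¬ e.IsDiag).card ≤ k + 1 := by
      refine le_trans (Finset.card_le_card fun e he => ?_) hk₁
      rw [Finset.mem_filter] at he ⊢
      refine ⟨?_, he.2⟩
      have h1 := he.1
      simp only [EdgeInduction.fracEdges, Finset.mem_filter, Finset.mem_univ, true_and] at h1 ⊢
      rwa [hwdef, if_neg he.2.2] at h1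
    -- the induction hypothesis, transported into any proper vertex set
    have IH : ∀ (w' : Sym2 (Fin n) → unitInterval) (S : Finset (Fin n)), S.card < n → ∀ {x t₁ t₂ t₃ : Fin n},
        x ∈ S → t₁ ∈ S → t₂ ∈ S → t₃ ∈ S →
        0 ≤ sahiE3 (prodBernoulli w') (openConnIn (↑S : Set (Fin n)) x t₁) (openConnIn (↑S : Set (Fin n)) x t₂)
          (openConnIn (↑S : Set (Fin n)) x t₃) :=
      fun w' S hS x t₁ t₂ t₃ hx h₁ h₂ h₃ => incStar_openConnIn_of_fin (ih S.card hS) w' S rfl hx h₁ h₂ h₃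
    -- (1) a cut vertex
    by_cases hI1 : ∀ (V₁ V₂ : Finset (Fin n)) (x : Fin n), (∀ y, y ∈ V₁ → y ∈ V₂ → y = x) → x ∈ V₁ → x ∈ V₂ → s ∈ V₁ →
        (∀ y, y ∈ V₁ ∨ y ∈ V₂) → (∀ y z, y ∈ V₁ → z ∈ V₂ → y ≠ x → z ≠ x → w s(y, z) = 0) →
        (∀ y ∈ V₁, y = x) ∨ (∀ z ∈ V₂, z = x)
    swap
    · push Not at hI1
      obtain ⟨V₁, V₂, x, hV, hx₁, hx₂, hs₁, hunion, hsep, ⟨y₀, hy₀, hy₀x⟩, ⟨z₀, hz₀, hz₀x⟩⟩ := hI1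
      have hz₀V₁ : z₀ ∉ V₁ := fun h => hz₀x (hV z₀ h hz₀)
      have hy₀V₂ : y₀ ∉ V₂ := fun h => hy₀x (hV y₀ hy₀ h)
      have hlt₁ : V₁.card < n := by simpa [hcardn] using Finset.card_lt_univ_of_notMem hz₀V₁
      have hlt₂ : V₂.card < n := by simpa [hcardn] using Finset.card_lt_univ_of_notMem hy₀V₂
      refine IncStarCutVertex.incStar_of_cutVertex w (V₁ := (↑V₁ : Set (Fin n))) (V₂ := (↑V₂ : Set (Fin n)))
        (a := x) (s := s) (fun y hy hy' => hV y hy hy') hx₁ hx₂ hs₁ (fun y => ?_) (fun y z hy hz hyx hzx => hsep y z hy hz hyx hzx)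
        (fun p q r hp hq hr => IH w V₁ hlt₁ hs₁ hp hq hr) (fun p q r hp hq hr => IH w V₂ hlt₂ hx₂ hp hq hr) a b c
      rcases hunion y with h | h
      · exact Or.inl h
      · exact Or.inr h
    -- (2) an unmarked vertex of degree ≤ 2 (series / pendant / isolated)
    by_cases hI2 : ∀ x y y' : Fin n, x ≠ s → x ≠ a → x ≠ b → x ≠ c → x ≠ y → x ≠ y' → y ≠ y' →
        ∃ z, z ≠ y ∧ z ≠ y' ∧ w s(x, z) ≠ 0
    swap
    · push Not at hI2
      obtain ⟨x, y, y', hxs, hxa, hxb, hxc, hxy, hxy', hyy', hdeg⟩ := hI2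
      -- the reduced weight
      have hval : (1 : ℝ) - (1 - w s(y, y')) * (1 - w s(x, y) * w s(x, y')) ∈ unitInterval := by
        have p0 := (w s(y, y')).2.1; have p1 := (w s(y, y')).2.2
        have q0 := (w s(x, y)).2.1; have q1 := (w s(x, y)).2.2
        have r0 := (w s(x, y')).2.1; have r1 := (w s(x, y')).2.2
        constructor <;> nlinarith [mul_nonneg q0 r0, mul_le_one₀ q1 r0 r1]
      obtain ⟨w', hw'def⟩ : ∃ w' : Sym2 (Fin n) → unitInterval, ∀ e, w' e =
          if x ∈ e then 0 else if e = s(y, y') then ⟨_, hval⟩ else w e := ⟨_, fun e => rfl⟩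
      have hw'x : ∀ z, w' s(x, z) = 0 := fun z => by rw [hw'def, if_pos (Sym2.mem_mk_left x z)]
      have hw'e : ∀ e, x ∉ e → e ≠ s(y, y') → w' e = w e := fun e he hne => by rw [hw'def, if_neg he, if_neg hne]
      have hw'yy : (w' s(y, y') : ℝ) = 1 - (1 - w s(y, y')) * (1 - w s(x, y) * w s(x, y')) := by
        have hx : x ∉ s(y, y') := by
          intro h; rcases Sym2.mem_iff.1 h with h | h; exacts [hxy h, hxy' h]
        rw [hw'def, if_neg hx, if_pos rfl]
      have hred := SahiSeriesReduction.sahiE_principal_seriesReduce w w' hxy hxy' hyy' (Ne.symm hxs)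
        (fun z hz hz' => hdeg z hz hz') hw'x hw'e hw'yy
      rw [sahiE3_openConn_eq_of_sahiE_eq w w' (fun T hT => hred 3 T fun i hxT => ?_)]
      swap
      · rcases hT i x hxT with h | h | h; exacts [hxa h, hxb h, hxc h]
      -- under `w'` the vertex `x` is isolated: compute inside `univ.erase x`
      set S : Finset (Fin n) := Finset.univ.erase x with hSdef
      have hSexit : ∀ p ∈ (↑S : Set (Fin n)), ∀ q ∉ (↑S : Set (Fin n)), w' s(p, q) = 0 := by
        intro p _ q hq
        have hqx : q = x := by
          by_contra h; exact hq (Finset.mem_coe.2 (Finset.mem_erase.2 ⟨h, Finset.mem_univ q⟩))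
        rw [hqx, Sym2.eq_swap]; exact hw'x p
      have memS : ∀ {p : Fin n}, p ≠ x → p ∈ S := fun hp => Finset.mem_erase.2 ⟨hp, Finset.mem_univ _⟩
      rw [sahiE3_openConn_eq_openConnIn_of_no_exit w' (↑S) hSexit (Finset.mem_coe.2 (memS (Ne.symm hxs)))]
      have hScard : S.card < n := by
        rw [hSdef, Finset.card_erase_of_mem (Finset.mem_univ x), Finset.card_univ, hcardn]; omega
      exact IH w' S hScard (memS (Ne.symm hxs)) (memS (Ne.symm hxa)) (memS (Ne.symm hxb)) (memS (Ne.symm hxc))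
    -- (3) a blob
    by_cases hI3 : ∀ (B : Finset (Fin n)) (u v : Fin n), B.Nonempty → u ∉ B → v ∉ B → u ≠ v → s ∉ B → a ∉ B → b ∉ B →
        c ∉ B → ∃ x ∈ B, ∃ z, z ∉ B ∧ z ≠ u ∧ z ≠ v ∧ w s(x, z) ≠ 0
    swap
    · push Not at hI3
      obtain ⟨B, u, v, hBne, hu, hv, huv, hsB, haB, hbB, hcB, hblob⟩ := hI3
      obtain ⟨w', hw'B, -, -, hE⟩ := SahiBlobReduction.exists_blobReduce w B hu hv huv
        (fun x hx z hz hzu hzv => hblob x hx z hz hzu hzv)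
      rw [sahiE3_openConn_eq_of_sahiE_eq w w' (fun T hT => hE s hsB 3 T fun i t ht => ?_)]
      swap
      · rcases hT i t ht with rfl | rfl | rfl; exacts [haB, hbB, hcB]
      set S : Finset (Fin n) := Finset.univ \ B with hSdef
      have memS : ∀ {p : Fin n}, p ∉ B → p ∈ S := fun hp => Finset.mem_sdiff.2 ⟨Finset.mem_univ _, hp⟩
      have hSexit : ∀ p ∈ (↑S : Set (Fin n)), ∀ q ∉ (↑S : Set (Fin n)), w' s(p, q) = 0 := by
        intro p _ q hq
        have hqB : q ∈ B := by
          by_contra h; exact hq (Finset.mem_coe.2 (memS h))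
        rw [Sym2.eq_swap]; exact hw'B q hqB p
      rw [sahiE3_openConn_eq_openConnIn_of_no_exit w' (↑S) hSexit (Finset.mem_coe.2 (memS hsB))]
      have hScard : S.card < n := by
        obtain ⟨x₀, hx₀⟩ := hBne
        have : x₀ ∉ S := fun h => (Finset.mem_sdiff.1 h).2 hx₀
        simpa [hcardn] using Finset.card_lt_univ_of_notMem this
      exact IH w' S hScard (memS hsB) (memS haB) (memS hbB) (memS hcB)
    -- (4) a targetless root side
    by_cases hI4 : ∀ (R : Finset (Fin n)) (h u v : Fin n), s ∈ R → h ∈ R → h ≠ s → u ∉ R → v ∉ R → u ≠ v → a ∉ R →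
        b ∉ R → c ∉ R → ∃ x ∈ R, ∃ z, z ∉ R ∧ z ≠ u ∧ z ≠ v ∧ w s(x, z) ≠ 0
    swap
    · push Not at hI4
      obtain ⟨R, h, u, v, hsR, hhR, hhs, huR, hvR, huv, haR, hbR, hcR, hside⟩ := hI4
      refine SahiRootSide.incStar_of_rootSide w R hsR hhR (Ne.symm hhs) huR hvR huv
        (fun x hx z hz hzu hzv => hside x hx z hz hzu hzv) (fun w' _ _ x y z hx hy hz => ?_) haR hbR hcR
      set S : Finset (Fin n) := Finset.univ.erase s with hSdef
      have hS : (↑S : Set (Fin n)) = {t : Fin n | t ≠ s} := by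
        ext t; simp [hSdef]
      have memS : ∀ {p : Fin n}, p ≠ s → p ∈ S := fun hp => Finset.mem_erase.2 ⟨hp, Finset.mem_univ _⟩
      have hScard : S.card < n := by
        rw [hSdef, Finset.card_erase_of_mem (Finset.mem_univ s), Finset.card_univ, hcardn]; omega
      have key := IH w' S hScard (memS hhs) (memS hx) (memS hy) (memS hz)
      rwa [hS] at key
    -- (5) NEW: a vertex `x` separating the environment `G − s` (THEOREM G)
    by_cases hI5 : ∀ (L : Finset (Fin n)) (x : Fin n), x ≠ s → s ∉ L → x ∉ L → L.Nonempty → (∃ y, y ∉ L ∧ y ≠ s ∧ y ≠ x) →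
        ∃ y ∈ L, ∃ z, z ∉ L ∧ z ≠ s ∧ z ≠ x ∧ w s(y, z) ≠ 0
    swap
    · push Not at hI5
      obtain ⟨Lf, x, hxs, hsL, hxL, hLne, ⟨y₀, hy₀L, hy₀s, hy₀x⟩, hsep⟩ := hI5
      -- the far interior `R`
      set Rf : Finset (Fin n) := Finset.univ.filter fun y => y ∉ Lf ∧ y ≠ s ∧ y ≠ x with hRfdef
      have memRf : ∀ {y : Fin n}, y ∈ Rf ↔ y ∉ Lf ∧ y ≠ s ∧ y ≠ x := fun {y} => by simp [hRfdef]
      have hRne : Rf.Nonempty := ⟨y₀, memRf.2 ⟨hy₀L, hy₀s, hy₀x⟩⟩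
      have hsR : s ∉ Rf := fun h => (memRf.1 h).2.1 rfl
      have hxR : x ∉ Rf := fun h => (memRf.1 h).2.2 rfl
      -- the separation, seen from either side
      have sepL : ∀ y z : Fin n, y ∈ (↑Lf : Set (Fin n)) → z ∉ (↑Lf : Set (Fin n)) → z ≠ s → z ≠ x → w s(y, z) = 0 :=
        fun y z hy hz hzs hzx => hsep y (Finset.mem_coe.1 hy) z (fun h => hz (Finset.mem_coe.2 h)) hzs hzx
      have sepR : ∀ y z : Fin n, y ∈ (↑Rf : Set (Fin n)) → z ∉ (↑Rf : Set (Fin n)) → z ≠ s → z ≠ x → w s(y, z) = 0 := by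
        intro y z hy hz hzs hzx
        have hy' := memRf.1 (Finset.mem_coe.1 hy)
        have hzL : z ∈ Lf := by
          by_contra h; exact hz (Finset.mem_coe.2 (memRf.2 ⟨h, hzs, hzx⟩))
        rw [Sym2.eq_swap]; exact hsep z hzL y hy'.1 hy'.2.1 hy'.2.2
      -- a targetless side contradicts the no-blob clause (3)
      have noBlob : ∀ (N : Finset (Fin n)), N.Nonempty → s ∉ N → x ∉ N →
          (∀ y z : Fin n, y ∈ (↑N : Set (Fin n)) → z ∉ (↑N : Set (Fin n)) → z ≠ s → z ≠ x → w s(y, z) = 0) →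
          a ∉ N → b ∉ N → c ∉ N → False := by
        intro N hNne hsN hxN hsepN haN hbN hcN
        obtain ⟨y, hy, z, hz, hzs, hzx, hne⟩ := hI3 N s x hNne hsN hxN hxs.symm hsN haN hbN hcN
        exact hne (hsepN y z (Finset.mem_coe.2 hy) (fun h => hz (Finset.mem_coe.1 h)) hzs hzx)
      -- THEOREM G from either side: one target on the near side `N`, the other two off `N ∪ {s}`
      have glue : ∀ (N : Finset (Fin n)), N.Nonempty → s ∉ N → x ∉ N →
          (∀ y z : Fin n, y ∈ (↑N : Set (Fin n)) → z ∉ (↑N : Set (Fin n)) → z ≠ s → z ≠ x → w s(y, z) = 0) →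
          ∀ {t u v : Fin n}, t ∈ N → u ∉ N → u ≠ s → v ∉ N → v ≠ s →
          0 ≤ sahiE3 (prodBernoulli w) (openConn s t) (openConn s u) (openConn s v) := by
        intro N hNne hsN hxN hsepN t u v ht hu hus hv hvs
        refine IncStar.incStar_nonneg_of_twoSep w (↑N : Set (Fin n)) hxs (fun h => hsN (Finset.mem_coe.1 h))
          (fun h => hxN (Finset.mem_coe.1 h)) (Finset.mem_coe.2 ht) (fun h => hu (Finset.mem_coe.1 h)) hus
          (fun h => hv (Finset.mem_coe.1 h)) hvs hsepN fun q _ => ?_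
        set S : Finset (Fin n) := Finset.univ \ N with hSdef
        have memS : ∀ {p : Fin n}, p ∉ N → p ∈ S := fun hp => Finset.mem_sdiff.2 ⟨Finset.mem_univ _, hp⟩
        have hS : (↑S : Set (Fin n)) = (↑N : Set (Fin n))ᶜ := by
          ext p; simp [hSdef]
        have hScard : S.card < n := by
          obtain ⟨x₀, hx₀⟩ := hNne
          have : x₀ ∉ S := fun h => (Finset.mem_sdiff.1 h).2 hx₀
          simpa [hcardn] using Finset.card_lt_univ_of_notMem this
        rw [← hS]
        exact IH _ S hScard (memS hsN) (memS hxN) (memS hu) (memS hv)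
      -- eight placements of the targets
      by_cases haL : a ∈ Lf
      · by_cases hbL : b ∈ Lf
        · by_cases hcL : c ∈ Lf
          · exact (noBlob Rf hRne hsR hxR sepR (fun h => (memRf.1 h).1 haL) (fun h => (memRf.1 h).1 hbL)
              (fun h => (memRf.1 h).1 hcL)).elim
          · -- near side `R` with the single target `c` (or no target if `c = x`)
            by_cases hcx : c = x
            · exact (noBlob Rf hRne hsR hxR sepR (fun h => (memRf.1 h).1 haL) (fun h => (memRf.1 h).1 hbL)
                (fun h => hxR (hcx ▸ h))).elim
            · have hcR : c ∈ Rf := memRf.2 ⟨hcL, hsc.symm, hcx⟩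
              rw [sahiE3_comm₂₃, sahiE3_comm₁₂]
              exact glue Rf hRne hsR hxR sepR hcR (fun h => (memRf.1 h).1 haL) hsa.symm (fun h => (memRf.1 h).1 hbL) hsb.symm
        · by_cases hcL : c ∈ Lf
          · by_cases hbx : b = x
            · exact (noBlob Rf hRne hsR hxR sepR (fun h => (memRf.1 h).1 haL) (fun h => hxR (hbx ▸ h))
                (fun h => (memRf.1 h).1 hcL)).elim
            · have hbR : b ∈ Rf := memRf.2 ⟨hbL, hsb.symm, hbx⟩
              rw [sahiE3_comm₁₂]
              exact glue Rf hRne hsR hxR sepR hbR (fun h => (memRf.1 h).1 haL) hsa.symm (fun h => (memRf.1 h).1 hcL) hsc.symm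
          · exact glue Lf hLne hsL hxL sepL haL hbL hsb.symm hcL hsc.symm
      · by_cases hbL : b ∈ Lf
        · by_cases hcL : c ∈ Lf
          · by_cases hax' : a = x
            · exact (noBlob Rf hRne hsR hxR sepR (fun h => hxR (hax' ▸ h)) (fun h => (memRf.1 h).1 hbL)
                (fun h => (memRf.1 h).1 hcL)).elim
            · have haR : a ∈ Rf := memRf.2 ⟨haL, hsa.symm, hax'⟩
              exact glue Rf hRne hsR hxR sepR haR (fun h => (memRf.1 h).1 hbL) hsb.symm (fun h => (memRf.1 h).1 hcL) hsc.symm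
          · rw [sahiE3_comm₁₂]
            exact glue Lf hLne hsL hxL sepL hbL haL hsa.symm hcL hsc.symm
        · by_cases hcL : c ∈ Lf
          · rw [sahiE3_comm₂₃, sahiE3_comm₁₂]
            exact glue Lf hLne hsL hxL sepL hcL haL hsa.symm hbL hsb.symm
          · exact (noBlob Lf hLne hsL hxL sepL haL hbL hcL).elim
    -- (6) NEW: an environment with at most one cycle (gen 21)
    by_cases hI6 : ∀ z₀ : Sym2 (Fin n),
        ¬ ((SimpleGraph.fromEdgeSet {z : Sym2 (Fin n) | s ∉ z ∧ w z ≠ 0}).deleteEdges {z₀}).IsAcyclic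
    swap
    · push Not at hI6
      obtain ⟨z₀, hz₀⟩ := hI6
      exact IncStar.incStar_nonneg_of_apexUnicyclic w s a b c z₀ hz₀
    -- (7) NEW: no fractional environment pair — the base of the inner induction
    by_cases hI7 : ∃ e : Sym2 (Fin n), s ∉ e ∧ ¬ e.IsDiag ∧ e ∈ EdgeInduction.fracEdges w
    swap
    · refine ihk w s a b c ?_
      have h0 : ((EdgeInduction.fracEdges w).filter fun e => s ∉ e ∧ ¬ e.IsDiag) = ∅ := by
        refine Finset.eq_empty_of_forall_notMem fun e he => ?_
        rw [Finset.mem_filter] at he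
        exact hI7 ⟨e, he.2.1, he.2.2, he.1⟩
      rw [h0, Finset.card_empty]; exact Nat.zero_le _
    -- (8) NEW: a fractional environment pair with an endpoint value below `E₃(w)` — the inner induction hypothesis at that endpoint
    by_cases hI8 : ∀ e : Sym2 (Fin n), s ∉ e → ¬ e.IsDiag → e ∈ EdgeInduction.fracEdges w →
        sahiE3 (prodBernoulli w) (openConn s a) (openConn s b) (openConn s c)
            < sahiE3 (prodBernoulli (Function.update w e 0)) (openConn s a) (openConn s b) (openConn s c) ∧
          sahiE3 (prodBernoulli w) (openConn s a) (openConn s b) (openConn s c)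
            < sahiE3 (prodBernoulli (Function.update w e 1)) (openConn s a) (openConn s b) (openConn s c)
    swap
    · push Not at hI8
      obtain ⟨e, hse, hnd, hfr, hmin⟩ := hI8
      have hmemf : e ∈ (EdgeInduction.fracEdges w).filter fun f => s ∉ f ∧ ¬ f.IsDiag := Finset.mem_filter.2 ⟨hfr, hse, hnd⟩
      have hcard : ∀ (u : unitInterval), u = 0 ∨ u = 1 →
          ((EdgeInduction.fracEdges (Function.update w e u)).filter fun f => s ∉ f ∧ ¬ f.IsDiag).card ≤ k := by
        intro u hu
        have hsub : ((EdgeInduction.fracEdges (Function.update w e u)).filter fun f => s ∉ f ∧ ¬ f.IsDiag) ⊆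
            ((EdgeInduction.fracEdges w).filter fun f => s ∉ f ∧ ¬ f.IsDiag).erase e := by
          intro f hf
          rw [Finset.mem_filter] at hf
          have hf' := EdgeInduction.fracEdges_update_subset w e u hu hf.1
          rw [Finset.mem_erase] at hf' ⊢
          exact ⟨hf'.1, Finset.mem_filter.2 ⟨hf'.2, hf.2⟩⟩
        have h1 := Finset.card_le_card hsub
        rw [Finset.card_erase_of_mem hmemf] at h1
        omega
      by_cases h0 : sahiE3 (prodBernoulli (Function.update w e 0)) (openConn s a) (openConn s b) (openConn s c)
          ≤ sahiE3 (prodBernoulli w) (openConn s a) (openConn s b) (openConn s c)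
      · exact le_trans (ihk _ s a b c (hcard 0 (Or.inl rfl))) h0
      · exact le_trans (ihk _ s a b c (hcard 1 (Or.inr rfl))) (hmin (lt_of_not_ge h0))
    -- (9) irreducible, 2-connected environment with ≥ 2 cycles, E-MIN violated along every fractional environment pair: the hypothesis
    exact H n w s a b c hsa hsb hsc hab hac hbc hloop hI1 hI2 hI3 hI4 hI5 hI6 hI7 hI8
  -- transport to an arbitrary finite vertex type
  have key := incStar_openConnIn_of_fin (V := V) (m := Fintype.card V) (fun w₀ s a b c => finv _ w₀ s a b c) w
    Finset.univ Finset.card_univ (Finset.mem_univ s) (Finset.mem_univ a) (Finset.mem_univ b) (Finset.mem_univ c)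
  rw [Finset.coe_univ] at key
  simpa only [openConn_eq_openConnIn_univ] using key

end IncStarIrreducible

end Summit.CriticalPhenomena.PercolationContinuityZ3.Theorems
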